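import Mathlib
import HarnessLib
import Summits.AtomisticToContinuum.FouriersLaw.Theses.JunctionLocality
import Summits.AtomisticToContinuum.FouriersLaw.Theorems.JunctionLocalitySuperadditiveResistanceStubInsertionIdentity
import Summits.AtomisticToContinuum.FouriersLaw.Theorems.JunctionLocalitySuperadditiveResistancePlainResponseUnique
import Summits.AtomisticToContinuum.FouriersLaw.Theorems.JunctionLocalitySuperadditiveResistanceStubPlainForwardField
import Summits.AtomisticToContinuum.FouriersLaw.Theorems.JunctionLocalitySuperadditiveResistanceKuboGauss
import Summits.AtomisticToContinuum.FouriersLaw.Theorems.JunctionLocalitySuperadditiveResistanceStubPlainKuboLinkAux1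

/-!
# Existence of the plain chain's first-order response field (clauses 1–2 of `PlainFrame`;
stub `stub_linearResponsePlain` of line `thermalise-then-cut-probe-insertion`, crux stmt-AtomisticToContinuum-11748)

Helper file (`--supports` stmt-AtomisticToContinuum-11748). For the pinned anharmonic chain
`pinnedChain ω₂ lam β γ` (all parameters `> 0`), `T > 0` and every `L ≥ 1`:

* `exists_smooth_poisson` — the hypoelliptic POISSON PROBLEM AT EQUILIBRIUM for a general source:
  for every smooth `k` with `|k| ≤ K e^{H/4T}` and `μ_T(k) = 0` there is a smooth, mean-zero
  `g ∈ L²(μ_T)` with `L_{T,T} g = −k` pointwise (`g = ∫₀^∞ P_t k dt` recentred: exponential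
  ergodicity of the equilibrium semigroup, CEHR 2018 Thm 2.13 (3); distributional Poisson equation
  and Hörmander regularity from the sibling stub's helpers `…StubPlainForwardFieldAux1/3`);
* `exists_classical_responseField` — MOMENTUM REVERSAL: with `W = (γ/2T²)(p_0² − p_{L−1}²)` (even in
  `p`, mean zero) and `g_W` its Poisson field, `h := g_W ∘ Θ` (`Θ(q,p) = (q,−p)`) is a smooth,
  mean-zero, `L²(μ_T)` CLASSICAL solution of the `μ_T`-adjoint equation `−X_H h + γ S h = −W`
  (`X_H(u∘Θ) = −(X_H u)∘Θ`, `S(u∘Θ) = (Su)∘Θ`, `μ_T` is `Θ`-invariant);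
* `isPlainResponseField_of_classical`, `exists_isPlainResponseField` — hence (integration by parts
  against `C_c^∞`, `integral_generator_mul_eq_adjoint`) `h` is a weak `L²(μ_T)` response field:
  `IsPlainResponseField (pinnedChain …) T L h` — clause 1 of the line's `PlainFrame` is a THEOREM;
* `isPlainResponseField_unique`, `plainFrame_iff` — with the landed uniqueness
  (`plainResponseField_unique`) the frame `PlainFrame P T L h G` for a response field `h` is
  equivalent to the single Kubo-link equation `G = γ(1/2 − ⟨p_0² − T, h⟩_{μ_T})`.

References: Cuneo–Eckmann–Hairer–Rey-Bellet, EJP 23 (2018) no. 55, Thm 2.13; L. Hörmander, Acta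
Math. 119 (1967), Thm 1.1; Eckmann–Pillet–Rey-Bellet, CMP 201 (1999) §3 (`L* = ΠLΠ`).
-/

noncomputable section

open MeasureTheory Filter Topology ProbabilityTheory Set
open scoped ContDiff NNReal
open Literature.MathematicalPhysics.KineticTheory.HeatConduction
open Literature.MathematicalPhysics.KineticTheory Literature.Analysis.Distribution OscillatorChain
open Summit.AtomisticToContinuum.FouriersLaw.Theorems.SubdiffusiveBondHeat
open Summit.AtomisticToContinuum.FouriersLaw.Theorems.SuperadditiveResistance.PlainForwardField
open Summit.AtomisticToContinuum.FouriersLaw.Theorems.SuperadditiveResistance.DeviceLiouville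
  (liouvilleOp bathOp generator_eq_liouvilleOp_add integral_generator_mul_eq_adjoint kin_eq_sq
    plainResponseField_unique continuous_liouvilleOp continuous_bathOp)
open Summit.AtomisticToContinuum.FouriersLaw.Theorems.SuperadditiveResistance.Kubo (memLp_kinetic)
open Summit.AtomisticToContinuum.FouriersLaw.Cruxes.SuperadditiveResistance.FloatingProbeBypassLaplacian
  (contDiff_flip integral_flip_gibbsMeasure memLp_flip_gibbsMeasure adjoint_flip_eq_generator)

namespace Summit.AtomisticToContinuum.FouriersLaw.Cruxes.SuperadditiveResistance.ThermaliseThenCutProbeInsertion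

/-! ## The Poisson problem at equilibrium for a general exponentially dominated source -/

section Poisson

variable {ω₂ lam β γ : ℝ} (hω : 0 < ω₂) (hl : 0 ≤ lam) (hβ : 0 < β) (hγ : 0 < γ) {L : ℕ} (hL : 0 < L)
  {T : ℝ} (hT : 0 < T)
include hω hl hβ hγ hL hT

/-- **Exponential decay of `P_t k` for a mean-zero `e^{H/4T}`-dominated observable**:
`|P_t k(z)| ≤ M e^{H(z)/4T} e^{−ct}` (CEHR (2.5) at equilibrium with the limit identified as `μ_T`,
`pinnedChain_exp_convergence_gibbs`, and `μ_T(k) = 0`). [cite: CuneoEckmannHairerReyBellet2018, Thm 2.13 (3)] -/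
theorem abs_act_le_of_integral_eq_zero {k : PhaseSpace L → ℝ} (hkc : Continuous k) {K : ℝ}
    (hkb : ∀ y, |k y| ≤ K * Real.exp (1 / (4 * T) * (pinnedChain ω₂ lam β γ).hamiltonian L y))
    (hk0 : ∫ y, k y ∂((pinnedChain ω₂ lam β γ).gibbsMeasure L T) = 0) :
    ∃ M c : ℝ, 0 < c ∧ ∀ (t : ℝ≥0) (z : PhaseSpace L),
      |∫ y, k y ∂((pinnedChain ω₂ lam β γ).langevinKernel L T T t z)| ≤
        M * Real.exp (1 / (4 * T) * (pinnedChain ω₂ lam β γ).hamiltonian L z) * Real.exp (-c * t) := by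
  set P := pinnedChain ω₂ lam β γ with hP
  set ϑ : ℝ := 1 / (4 * T) with hϑ
  have hϑ0 : 0 < ϑ := by positivity
  have hϑ1 : ϑ < 1 / T := by rw [hϑ, div_lt_div_iff₀ (by positivity) hT]; nlinarith
  -- a positive domination constant
  set K' : ℝ := max K 1 with hK'
  have hK'0 : 0 < K' := lt_of_lt_of_le one_pos (le_max_right _ _)
  have hkb' : ∀ y, |k y| ≤ K' * Real.exp (ϑ * P.hamiltonian L y) := fun y =>
    (hkb y).trans (mul_le_mul_of_nonneg_right (le_max_left _ _) (Real.exp_pos _).le)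
  obtain ⟨C, c, hC, hc, hb⟩ := pinnedChain_exp_convergence_gibbs hω hl hβ hγ hL hT hϑ0 hϑ1
  refine ⟨K' * C, c, hc, fun t z => ?_⟩
  have hfc : Continuous fun y => k y / K' := hkc.div_const K'
  have hfb : ∀ y, |k y / K'| ≤ Real.exp (ϑ * P.hamiltonian L y) := fun y => by
    rw [abs_div, abs_of_pos hK'0, div_le_iff₀ hK'0, mul_comm]
    exact hkb' y
  have h := hb z t (fun y => k y / K') hfc hfb
  rw [integral_div, integral_div, hk0, zero_div, sub_zero,
    ← pinnedChain_langevinKernel_eq_transitionKernel L T T hω hl hβ.le hγ.le t, abs_div,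
    abs_of_pos hK'0, div_le_iff₀ hK'0] at h
  calc |∫ y, k y ∂(P.langevinKernel L T T t z)|
      ≤ C * Real.exp (ϑ * P.hamiltonian L z) * Real.exp (-c * t) * K' := h
    _ = K' * C * Real.exp (1 / (4 * T) * P.hamiltonian L z) * Real.exp (-c * t) := by rw [hϑ]; ring

/-- **The Poisson problem at equilibrium** for the plain chain (`L_{T,T} = X_H + γ S`): every smooth
source `k` with `|k| ≤ K e^{H/4T}` and `μ_T(k) = 0` has a smooth, mean-zero potential `g ∈ L²(μ_T)`,
`L_{T,T} g = −k` pointwise — the forward integral `∫₀^∞ P_t k dt` (its distributional Poisson equation: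
`integral_transpose_mul_forwardIntegral`; hypoelliptic regularity: `exists_smooth_ae_eq_of_weak_poisson`;
`e^{H/4T}`-domination gives `L²(μ_T)`), recentred.
[cite: CuneoEckmannHairerReyBellet2018, Thm 2.13] [cite: Hormander1967, Thm 1.1] -/
theorem exists_smooth_poisson {k : PhaseSpace L → ℝ} (hks : ContDiff ℝ ∞ k) {K : ℝ}
    (hkb : ∀ y, |k y| ≤ K * Real.exp (1 / (4 * T) * (pinnedChain ω₂ lam β γ).hamiltonian L y))
    (hk0 : ∫ y, k y ∂((pinnedChain ω₂ lam β γ).gibbsMeasure L T) = 0) :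
    ∃ g : PhaseSpace L → ℝ, ContDiff ℝ ∞ g ∧ MemLp g 2 ((pinnedChain ω₂ lam β γ).gibbsMeasure L T) ∧
      ∫ x, g x ∂((pinnedChain ω₂ lam β γ).gibbsMeasure L T) = 0 ∧
      ∀ x, (pinnedChain ω₂ lam β γ).generator L T T g x = -k x := by
  haveI := isAddHaarMeasure_volume_phaseSpace L
  set P := pinnedChain ω₂ lam β γ with hP
  have hU : ContDiff ℝ ∞ P.U := pinnedChain_contDiff_U ω₂ lam β γ
  have hV : ContDiff ℝ ∞ P.V := pinnedChain_contDiff_V ω₂ lam β γ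
  have hγ' : P.γ = γ := rfl
  have hγT : 0 ≤ P.γ * T := by rw [hγ']; positivity
  set ϑ : ℝ := 1 / (4 * T) with hϑ
  have hϑ0 : 0 < ϑ := by positivity
  have hϑ1 : ϑ < 1 / T := by rw [hϑ, div_lt_div_iff₀ (by positivity) hT]; nlinarith
  have h2ϑ : 2 * ϑ < 1 / T := by
    rw [hϑ, show 2 * (1 / (4 * T)) = 1 / (2 * T) by field_simp; ring, div_lt_div_iff₀ (by positivity) hT]
    nlinarith
  have hkc : Continuous k := hks.continuous
  obtain ⟨M, c, hc, hdecay⟩ := abs_act_le_of_integral_eq_zero hω hl hβ hγ hL hT hkc hkb hk0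
  set Hm := P.hamiltonian L with hHm
  have hHc : Continuous Hm := pinnedChain_continuous_hamiltonian ω₂ lam β γ L
  -- the candidate `g₀ = ∫₀^∞ P_t k dt`
  set g₀ : PhaseSpace L → ℝ := fun x => ∫ t in Ioi (0 : ℝ),
    ∫ y, k y ∂(P.langevinKernel L T T t.toNNReal x) with hg₀
  have hg₀m : StronglyMeasurable g₀ := stronglyMeasurable_forwardIntegral hω hl hβ.le hγ.le hkc
  set M' : ℝ := M * ∫ t in Ioi (0 : ℝ), Real.exp (-c * t) with hM'
  have hg₀b : ∀ x, |g₀ x| ≤ M' * Real.exp (ϑ * Hm x) := fun x =>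
    abs_forwardIntegral_le k hc hdecay x
  set B : PhaseSpace L → ℝ := fun x => M' * Real.exp (ϑ * Hm x) with hB
  have hBc : Continuous B := by rw [hB]; fun_prop
  have hg₀B : ∀ x, ‖g₀ x‖ ≤ ‖B x‖ := fun x => by
    rw [Real.norm_eq_abs, Real.norm_eq_abs]
    exact (hg₀b x).trans (le_abs_self _)
  have hg₀loc : LocallyIntegrable g₀ volume :=
    hBc.locallyIntegrable.mono hg₀m.aestronglyMeasurable (Eventually.of_forall hg₀B)
  -- the Poisson equation in `𝓓'`
  have hweak₀ : ∀ φ : PhaseSpace L → ℝ, ContDiff ℝ ∞ φ → HasCompactSupport φ →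
      ∫ x, g₀ x * hormanderTranspose (P.drift L) (P.bathField hL T T) (fun _ => 0) φ x =
        ∫ x, (-k x) * φ x := by
    intro φ hφ hφc
    have h := integral_transpose_mul_forwardIntegral hω hl hβ.le hγ.le hL hT hϑ0 hϑ1 hc hks hkb hdecay hφ hφc
    calc ∫ x, g₀ x * hormanderTranspose (P.drift L) (P.bathField hL T T) (fun _ => 0) φ x
        = ∫ x, (sdeGenerator (fun y => -P.drift L y) (P.bathVecL L T) (P.bathVecR L T) φ x +
            2 * γ * φ x) * g₀ x := by
          refine integral_congr_ae (ae_of_all _ fun x => ?_)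
          dsimp only
          rw [hormanderTranspose_generatorFamily_eq_revGenerator P hU hV hL hγT hγT hφ x, hγ', mul_comm]
      _ = -∫ x, φ x * k x := h
      _ = ∫ x, (-k x) * φ x := by
          rw [← integral_neg]
          exact integral_congr_ae (ae_of_all _ fun x => by ring)
  -- hypoelliptic regularity
  obtain ⟨g, hg, hae⟩ := exists_smooth_ae_eq_of_weak_poisson hβ.le hγ hL hT hg₀loc hks.neg hweak₀
  have hweak : ∀ φ : PhaseSpace L → ℝ, ContDiff ℝ ∞ φ → HasCompactSupport φ →
      ∫ x, g x * hormanderTranspose (P.drift L) (P.bathField hL T T) (fun _ => 0) φ x =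
        ∫ x, (-k x) * φ x := by
    intro φ hφ hφc
    rw [← hweak₀ φ hφ hφc]
    refine integral_congr_ae ?_
    filter_upwards [hae] with x hx
    rw [hx]
  have hclass : ∀ x, P.generator L T T g x = -k x :=
    generator_eq_of_weak_poisson P hU hV hL hγT hγT hg hkc.neg hweak
  -- square integrability for `μ_T`
  set μ := P.gibbsMeasure L T with hμ
  haveI : IsProbabilityMeasure μ := pinnedChain_isProbabilityMeasure_gibbsMeasure hω hl hβ.le γ L hT
  have haeμ : g₀ =ᵐ[μ] g := (P.gibbsMeasure_absolutelyContinuous L T).ae_le hae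
  have hBL2 : MemLp B 2 μ := by
    rw [memLp_two_iff_integrable_sq hBc.aestronglyMeasurable]
    have h2 := pinnedChain_integrable_exp_mul_hamiltonian_gibbsMeasure hω hl hβ.le γ L hT h2ϑ
    refine (h2.const_mul (M' ^ 2)).congr (Eventually.of_forall fun x => ?_)
    have e : (M' * Real.exp (ϑ * Hm x)) ^ 2 = M' ^ 2 * Real.exp (2 * ϑ * Hm x) := by
      rw [mul_pow, ← Real.exp_nat_mul]; ring_nf
    show M' ^ 2 * Real.exp (2 * ϑ * Hm x) = (M' * Real.exp (ϑ * Hm x)) ^ 2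
    rw [e]
  have hgL2 : MemLp g 2 μ := by
    refine hBL2.of_le hg.continuous.aestronglyMeasurable ?_
    filter_upwards [haeμ] with x hx
    rw [← hx]
    exact hg₀B x
  -- recentring
  set c₀ : ℝ := ∫ x, g x ∂μ with hc₀
  refine ⟨fun x => g x - c₀, hg.sub contDiff_const, hgL2.sub (memLp_const c₀), ?_, ?_⟩
  · have hgi : Integrable g μ := hgL2.integrable (by norm_num)
    rw [integral_sub hgi (integrable_const c₀), integral_const]
    simp [probReal_univ, hc₀]
  · intro x
    rw [OscillatorChain.generator_sub_const, hclass x]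

end Poisson

/-! ## The first-order source `W` of the plain chain -/

section Source

variable {L : ℕ}

/-- Closed form of the source for `L ≥ 1`: `W = (γ/2T²)(p_0² − p_{L−1}²)` (the crux's `kin` is the
verbatim — definitionally equal — copy of `DeviceLiouville.kin`, whose `kin_eq_sq` applies). -/
theorem plainSource_eq (P : OscillatorChain) (T : ℝ) (hL : 0 < L) :
    plainSource P T L = fun x => P.γ / (2 * T ^ 2) *
      ((x.2 ⟨0, hL⟩ ^ 2 - T) - (x.2 ⟨L - 1, Nat.sub_lt hL one_pos⟩ ^ 2 - T)) := by
  funext x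
  rw [plainSource, (show kin L 0 x = x.2 ⟨0, hL⟩ ^ 2 from kin_eq_sq hL x),
    (show kin L (L - 1) x = x.2 ⟨L - 1, Nat.sub_lt hL one_pos⟩ ^ 2 from kin_eq_sq (Nat.sub_lt hL one_pos) x)]
  ring

/-- `W` is smooth. -/
theorem contDiff_plainSource (P : OscillatorChain) (T : ℝ) (hL : 0 < L) :
    ContDiff ℝ ∞ (plainSource P T L) := by
  rw [plainSource_eq P T hL]
  fun_prop

/-- `W` is even in the momenta. -/
theorem plainSource_flip (P : OscillatorChain) (T : ℝ) (x : PhaseSpace L) :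
    plainSource P T L (x.1, -x.2) = plainSource P T L x := by
  simp [plainSource, kin]

variable {ω₂ lam β γ : ℝ} (hω : 0 < ω₂) (hl : 0 ≤ lam) (hβ : 0 ≤ β) (hL : 0 < L) {T : ℝ} (hT : 0 < T)
include hω hl hβ hL hT

/-- `|W| ≤ K e^{H/4T}`. -/
theorem abs_plainSource_le :
    ∀ y, |plainSource (pinnedChain ω₂ lam β γ) T L y| ≤
      |γ| / (2 * T ^ 2) * (2 * (2 / (1 / (4 * T)) + T)) *
        Real.exp (1 / (4 * T) * (pinnedChain ω₂ lam β γ).hamiltonian L y) := by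
  intro y
  have hϑ0 : (0 : ℝ) < 1 / (4 * T) := by positivity
  have h0 := abs_sq_momentum_sub_le_exp (γ := γ) hω hl hβ hϑ0 hT.le y ⟨0, hL⟩
  have h1 := abs_sq_momentum_sub_le_exp (γ := γ) hω hl hβ hϑ0 hT.le y ⟨L - 1, Nat.sub_lt hL one_pos⟩
  rw [plainSource_eq _ T hL]
  dsimp only
  have hγ' : (pinnedChain ω₂ lam β γ).γ = γ := rfl
  rw [hγ', abs_mul, abs_div, abs_of_pos (by positivity : (0 : ℝ) < 2 * T ^ 2), mul_assoc]
  refine mul_le_mul_of_nonneg_left ?_ (by positivity)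
  calc |y.2 ⟨0, hL⟩ ^ 2 - T - (y.2 ⟨L - 1, Nat.sub_lt hL one_pos⟩ ^ 2 - T)|
      ≤ |y.2 ⟨0, hL⟩ ^ 2 - T| + |y.2 ⟨L - 1, Nat.sub_lt hL one_pos⟩ ^ 2 - T| := abs_sub _ _
    _ ≤ _ := by linarith

/-- `μ_T(W) = 0` (equipartition at both ends). -/
theorem integral_plainSource :
    ∫ y, plainSource (pinnedChain ω₂ lam β γ) T L y ∂((pinnedChain ω₂ lam β γ).gibbsMeasure L T) = 0 := by
  haveI := pinnedChain_isProbabilityMeasure_gibbsMeasure hω hl hβ γ L hT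
  rw [plainSource_eq _ T hL]
  have i0 : Integrable (fun x : PhaseSpace L => x.2 ⟨0, hL⟩ ^ 2 - T) ((pinnedChain ω₂ lam β γ).gibbsMeasure L T) :=
    (memLp_kinetic hω hl hβ L hT ⟨0, hL⟩).integrable one_le_two
  have i1 : Integrable (fun x : PhaseSpace L => x.2 ⟨L - 1, Nat.sub_lt hL one_pos⟩ ^ 2 - T)
      ((pinnedChain ω₂ lam β γ).gibbsMeasure L T) :=
    (memLp_kinetic hω hl hβ L hT ⟨L - 1, Nat.sub_lt hL one_pos⟩).integrable one_le_two
  rw [integral_const_mul, integral_sub i0 i1, pinnedChain_integral_kinObs_gibbsMeasure hω hl hβ γ L hT,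
    pinnedChain_integral_kinObs_gibbsMeasure hω hl hβ γ L hT, sub_zero, mul_zero]

/-- `W ∈ L²(μ_T)`. -/
theorem memLp_plainSource :
    MemLp (plainSource (pinnedChain ω₂ lam β γ) T L) 2 ((pinnedChain ω₂ lam β γ).gibbsMeasure L T) := by
  rw [plainSource_eq _ T hL]
  exact ((memLp_kinetic hω hl hβ L hT ⟨0, hL⟩).sub
    (memLp_kinetic hω hl hβ L hT ⟨L - 1, Nat.sub_lt hL one_pos⟩)).const_mul _

end Source

/-! ## The response field by momentum reversal -/

section Response

variable {ω₂ lam β γ : ℝ} {L : ℕ} {T : ℝ}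

/-- **A classical solution of the adjoint equation is a weak response field.** For the pinned chain
(`C^∞` potentials), `T ≠ 0`, and `h ∈ C²` with `−X_H h + γ S h = −W` pointwise: for every
`f ∈ C_c^∞`, `∫ (L_{T,T} f) h dμ_T = −∫ f W dμ_T` (`integral_generator_mul_eq_adjoint`). -/
theorem weak_of_classical_adjoint (hT : T ≠ 0) {h : PhaseSpace L → ℝ} (hh : ContDiff ℝ 2 h)
    (hpde : ∀ x, -liouvilleOp (pinnedChain ω₂ lam β γ) L h x +
      (pinnedChain ω₂ lam β γ).γ * bathOp L (OscillatorChain.bathWeight L) T h x =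
        -plainSource (pinnedChain ω₂ lam β γ) T L x)
    {f : PhaseSpace L → ℝ} (hf : ContDiff ℝ ∞ f) (hfc : HasCompactSupport f) :
    ∫ x, (pinnedChain ω₂ lam β γ).generator L T T f x * h x ∂((pinnedChain ω₂ lam β γ).gibbsMeasure L T) =
      -∫ x, f x * plainSource (pinnedChain ω₂ lam β γ) T L x ∂((pinnedChain ω₂ lam β γ).gibbsMeasure L T) := by
  set P := pinnedChain ω₂ lam β γ with hP
  have hU1 : ContDiff ℝ 1 P.U := pinnedChain_contDiff_U ω₂ lam β γ
  have hV1 : ContDiff ℝ 1 P.V := pinnedChain_contDiff_V ω₂ lam β γ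
  rw [P.integral_gibbsMeasure, P.integral_gibbsMeasure, ← mul_neg, ← integral_neg]
  congr 1
  have hadj := integral_generator_mul_eq_adjoint P hU1 hV1 L hT (hf.of_le (by norm_cast)) hfc hh
  have e1 : (fun x => P.generator L T T f x * h x * P.gibbsDensity L T x) =
      fun x => P.generator L T T f x * (h x * P.gibbsDensity L T x) := by
    funext x; ring
  rw [e1, hadj]
  refine integral_congr_ae (ae_of_all _ fun x => ?_)
  dsimp only
  rw [hpde x]
  ring

variable (hω : 0 < ω₂) (hl : 0 ≤ lam) (hβ : 0 < β) (hγ : 0 < γ) (hL : 0 < L) (hT : 0 < T)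
include hω hl hβ hγ hL hT

/-- **The classical response field by momentum reversal.** There is a smooth, mean-zero `h ∈ L²(μ_T)`
solving the `μ_T`-adjoint equation `−X_H h + γ S h = −W` POINTWISE: `h = g_W ∘ Θ` with `g_W` the
Poisson field of the (even, mean-zero, `e^{H/4T}`-dominated) source `W` and `Θ(q,p) = (q,−p)`
(`L_{T,T}^† (u∘Θ) = (L_{T,T} u)∘Θ`, `μ_T∘Θ = μ_T`). -/
theorem exists_classical_responseField :
    ∃ h : PhaseSpace L → ℝ, ContDiff ℝ ∞ h ∧ MemLp h 2 ((pinnedChain ω₂ lam β γ).gibbsMeasure L T) ∧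
      ∫ x, h x ∂((pinnedChain ω₂ lam β γ).gibbsMeasure L T) = 0 ∧
      ∀ x, -liouvilleOp (pinnedChain ω₂ lam β γ) L h x +
        (pinnedChain ω₂ lam β γ).γ * bathOp L (OscillatorChain.bathWeight L) T h x =
          -plainSource (pinnedChain ω₂ lam β γ) T L x := by
  set P := pinnedChain ω₂ lam β γ with hP
  obtain ⟨g, hg, hgL2, hgmean, hpde⟩ := exists_smooth_poisson hω hl hβ hγ hL hT
    (contDiff_plainSource P T hL) (abs_plainSource_le hω hl hβ.le hL hT) (integral_plainSource hω hl hβ.le hL hT)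
  refine ⟨fun x => g (x.1, -x.2), contDiff_flip hg, memLp_flip_gibbsMeasure P L T hgL2, ?_, fun x => ?_⟩
  · rw [integral_flip_gibbsMeasure P L T g, hgmean]
  · rw [adjoint_flip_eq_generator P T g x, hpde (x.1, -x.2), plainSource_flip]

/-- **Existence of the first-order response field of the plain chain (clause 1 of `PlainFrame`).**
For `pinnedChain ω₂ lam β γ` (all `> 0`; `lam ≥ 0` suffices), `T > 0`, `L ≥ 1` there is a mean-zero
`h ∈ L²(μ_T)` with `∫ (L_{T,T} f) h dμ_T = −∫ f W dμ_T` for all `f ∈ C_c^∞`. -/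
theorem exists_isPlainResponseField :
    ∃ h : PhaseSpace L → ℝ, IsPlainResponseField (pinnedChain ω₂ lam β γ) T L h := by
  obtain ⟨h, hh, hL2, hmean, hpde⟩ := exists_classical_responseField hω hl hβ hγ hL hT
  exact ⟨h, hL2, hmean, fun f hf hfc =>
    weak_of_classical_adjoint hT.ne' (hh.of_le (by norm_cast)) hpde hf hfc⟩

end Response

/-! ## Packaging: `PlainFrame` for a response field is the Kubo-link equation -/

section Frame

variable {ω₂ lam β γ : ℝ} {L : ℕ} {T : ℝ}
  (hω : 0 < ω₂) (hl : 0 ≤ lam) (hβ : 0 ≤ β) (hγ : 0 < γ) (hL : 0 < L) (hT : 0 < T)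
include hω hl hβ hγ hL hT

/-- **Clause 2 of `PlainFrame`**: the response field is unique `μ_T`-a.e. (the landed
`plainResponseField_unique`: Hörmander regularity, `μ_T`-adjoint identity, `L²(μ_T)`-Liouville). -/
theorem isPlainResponseField_unique {h h' : PhaseSpace L → ℝ}
    (hh : IsPlainResponseField (pinnedChain ω₂ lam β γ) T L h)
    (hh' : IsPlainResponseField (pinnedChain ω₂ lam β γ) T L h') :
    h' =ᵐ[(pinnedChain ω₂ lam β γ).gibbsMeasure L T] h := by
  obtain ⟨hL2, hmean, hweak⟩ := hh
  obtain ⟨hL2', hmean', hweak'⟩ := hh'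
  exact plainResponseField_unique hω hl hβ hγ hL hT
    (fun f => -∫ x, f x * plainSource (pinnedChain ω₂ lam β γ) T L x ∂((pinnedChain ω₂ lam β γ).gibbsMeasure L T))
    hL2 hmean hweak hL2' hmean' hweak'

/-- For a response field `h`, `PlainFrame P T L h G` is the single equation
`G = γ(1/2 − ⟨p_0² − T, h⟩_{μ_T})`. -/
theorem plainFrame_iff {h : PhaseSpace L → ℝ} (hh : IsPlainResponseField (pinnedChain ω₂ lam β γ) T L h)
    (G : ℝ) :
    PlainFrame (pinnedChain ω₂ lam β γ) T L h G ↔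
      G = (pinnedChain ω₂ lam β γ).γ *
        (1 / 2 - ∫ x, (kin L 0 x - T) * h x ∂((pinnedChain ω₂ lam β γ).gibbsMeasure L T)) :=
  ⟨fun hF => hF.2.2, fun hG => ⟨hh, fun _ hh' => isPlainResponseField_unique hω hl hβ hγ hL hT hh hh', hG⟩⟩

/-- The Kubo pairing `⟨p_0² − T, h⟩_{μ_T}` does not depend on the choice of the response field. -/
theorem integral_kin_mul_eq_of_isPlainResponseField {h h' : PhaseSpace L → ℝ}
    (hh : IsPlainResponseField (pinnedChain ω₂ lam β γ) T L h)
    (hh' : IsPlainResponseField (pinnedChain ω₂ lam β γ) T L h') :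
    ∫ x, (kin L 0 x - T) * h' x ∂((pinnedChain ω₂ lam β γ).gibbsMeasure L T) =
      ∫ x, (kin L 0 x - T) * h x ∂((pinnedChain ω₂ lam β γ).gibbsMeasure L T) := by
  refine integral_congr_ae ?_
  filter_upwards [isPlainResponseField_unique hω hl hβ hγ hL hT hh hh'] with x hx
  rw [hx]

end Frame

/-- **Clauses 1–2 of `PlainFrame` discharged**: for `pinnedChain ω₂ lam β γ` (all parameters `> 0`),
`T > 0`, `L ≥ 1` and every `G`, a response field `h` with `PlainFrame P T L h G` exists IFF the
Kubo-link equation `G = γ(1/2 − ⟨p_0² − T, h⟩_{μ_T})` holds for every (equivalently: some) response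
field `h` — existence (`exists_isPlainResponseField`) and a.e.-uniqueness make the pairing canonical. -/
theorem exists_plainFrame_iff {ω₂ lam β γ : ℝ} {L : ℕ} {T : ℝ} (hω : 0 < ω₂) (hl : 0 ≤ lam)
    (hβ : 0 < β) (hγ : 0 < γ) (hL : 0 < L) (hT : 0 < T) (G : ℝ) :
    (∃ h : PhaseSpace L → ℝ, PlainFrame (pinnedChain ω₂ lam β γ) T L h G) ↔
      ∀ h : PhaseSpace L → ℝ, IsPlainResponseField (pinnedChain ω₂ lam β γ) T L h →
        G = γ * (1 / 2 - ∫ x, (kin L 0 x - T) * h x ∂((pinnedChain ω₂ lam β γ).gibbsMeasure L T)) := by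
  have hγ' : (pinnedChain ω₂ lam β γ).γ = γ := rfl
  constructor
  · rintro ⟨h, hh, -, hG⟩ h' hh'
    rw [hG, hγ', integral_kin_mul_eq_of_isPlainResponseField hω hl hβ.le hγ hL hT hh hh']
  · intro H
    obtain ⟨h, hh⟩ := exists_isPlainResponseField hω hl hβ hγ hL hT
    exact ⟨h, (plainFrame_iff hω hl hβ.le hγ hL hT hh G).2 (by rw [hγ']; exact H h hh)⟩

/-! ## Registered helper sub-goal -/

/-- **Registered helper sub-goal of this file** (`helper_linearResponsePlainExists`): clauses 1–2 of the
line's `PlainFrame` — existence (`exists_isPlainResponseField`) and a.e.-uniqueness of the response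
field — in the form "a plain frame with coefficient `G` exists iff the Kubo-link equation
`G = γ(1/2 − ⟨p_0² − T, h⟩_{μ_T})` holds for the response field `h`" (= `exists_plainFrame_iff`). -/
theorem helper_linearResponsePlainExists : ∀ (ω₂ lam β γ T : ℝ), 0 < ω₂ → 0 ≤ lam → 0 < β → 0 < γ → 0 < T → ∀ (L : ℕ), 0 < L → ∀ (G : ℝ), (∃ h : PhaseSpace L → ℝ, PlainFrame (pinnedChain ω₂ lam β γ) T L h G) ↔ ∀ h : PhaseSpace L → ℝ, IsPlainResponseField (pinnedChain ω₂ lam β γ) T L h → G = γ * (1 / 2 - ∫ x, (kin L 0 x - T) * h x ∂((pinnedChain ω₂ lam β γ).gibbsMeasure L T)) :=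
  fun _ _ _ _ _ hω hl hβ hγ hT _ hL G => exists_plainFrame_iff hω hl hβ hγ hL hT G

end Summit.AtomisticToContinuum.FouriersLaw.Cruxes.SuperadditiveResistance.ThermaliseThenCutProbeInsertion

end
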